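import Literature.RingTheory.NoetherNormalization.LinearChange
import Literature.ModelTheory.ExponentialFields.TarskiSeidenbergProofs
import Mathlib.Algebra.Polynomial.BigOperators
import Mathlib.RingTheory.Polynomial.UniqueFactorization
import Mathlib.Algebra.MvPolynomial.Nilpotent
import HarnessLib

/-!
# Jung's projection method, algebraic preparation: sign presentation, rational shear, monic forms

First (purely algebraic) step of Jung's projection method for a `ℚ`-semialgebraic `B ⊆ ℝᵈ⁺¹` and a
finite family `Q` of non-zero polynomials over `ℚ` (as used for cube-monomialisation of bounded
semialgebraic sets):

* `B` is presented by sign conditions on a finite family `Ps` (`exists_eq_setOf_signVec_mem`);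
* after a rational shear `x_i ↦ x_i + v_i t` (`t` = last coordinate; the tree's
  `NoetherNormalization.linearChange` conjugated by `finRotate`), the product of the `Q_j` and the
  non-zero members of `Ps` becomes, as a polynomial in `t` over `ℚ[x_1, …, x_d]`, a constant times a
  MONIC polynomial `Rh` (`exists_linearChange_monic`, the first step of Noether normalisation); every
  `Q_j` (resp. non-zero `p ∈ Ps`) is then a non-zero rational constant times a monic divisor of `Rh`;
* the evaluation identity `q(Sh_v z) = q♯(z', z_d)` linking the sheared point
  `Sh_v z = (z_i + v_i z_d)_i, z_d)` with the last-variable form `q♯ ∈ ℚ[x][T]` (`aeval_shear`).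

Everything here is elementary algebra (namespace `Literature.NumberTheory.Transcendental.JungPreparation`).

## References

* H. W. E. Jung, J. reine angew. Math. 133 (1908), 289–314.
* G.-M. Greuel, G. Pfister, *A Singular Introduction to Commutative Algebra* (2002), Thm. 3.4.1.
* S. Basu, R. Pollack, M.-F. Roy, *Algorithms in Real Algebraic Geometry* (2006), §2.3.
-/

noncomputable section

open Polynomial
open Literature.ModelTheory.ExponentialFields (IsSemialgebraic)
open Literature.RingTheory.NoetherNormalization (linearChange exists_linearChange_monic)

namespace Literature.NumberTheory.Transcendental.JungPreparation

variable {d : ℕ}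

/-- The last-variable form `q♯ = finSuccEquiv (linearChange v (rename finRotate q)) ∈ ℚ[x][T]` of a
polynomial `q ∈ ℚ[x_0, …, x_d]` after the shear `x_i ↦ x_i + v_i t` evaluates at `(z', z_d)` to
`q` at the sheared point `Sh_v z = ((z_i + v_i z_d)_i, z_d)`. [folklore] -/
theorem aeval_shear (v : Fin d → ℚ) (q : MvPolynomial (Fin (d + 1)) ℚ) (z : Fin (d + 1) → ℝ) :
    ((MvPolynomial.finSuccEquiv ℚ d (linearChange v (MvPolynomial.rename (finRotate (d + 1)) q))).map
        (MvPolynomial.eval₂Hom (algebraMap ℚ ℝ) (Fin.init z))).eval (z (Fin.last d)) =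
      MvPolynomial.aeval (Fin.snoc (fun i : Fin d => z (Fin.castSucc i) +
        algebraMap ℚ ℝ (v i) * z (Fin.last d)) (z (Fin.last d)) : Fin (d + 1) → ℝ) q := by
  rw [Literature.ModelTheory.ExponentialFields.eval_map_finSuccEquiv, linearChange,
    MvPolynomial.aeval_eq_bind₁, MvPolynomial.aeval_bind₁, MvPolynomial.aeval_rename]
  have hpt : ((fun i : Fin (d + 1) => MvPolynomial.aeval (Fin.cons (z (Fin.last d)) (Fin.init z) :
        Fin (d + 1) → ℝ) ((Fin.cons (MvPolynomial.X 0)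
          (fun i : Fin d => MvPolynomial.X i.succ + MvPolynomial.C (v i) * MvPolynomial.X 0) :
          Fin (d + 1) → MvPolynomial (Fin (d + 1)) ℚ) i)) ∘ finRotate (d + 1)) =
      (Fin.snoc (fun i : Fin d => z (Fin.castSucc i) + algebraMap ℚ ℝ (v i) * z (Fin.last d))
        (z (Fin.last d)) : Fin (d + 1) → ℝ) := by
    rw [Fin.snoc_eq_cons_rotate]
    funext i
    simp only [Function.comp_apply]
    generalize finRotate (d + 1) i = j
    refine Fin.cases ?_ (fun i' => ?_) j
    · simp
    · simp [Fin.init]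
  rw [hpt]

/-- A unit of `ℚ[x_1, …, x_d]` is a non-zero rational constant. [folklore] -/
theorem exists_eq_C_of_isUnit {a : MvPolynomial (Fin d) ℚ} (ha : IsUnit a) :
    ∃ κ : ℚ, κ ≠ 0 ∧ a = MvPolynomial.C κ := by
  obtain ⟨κ, hκ, rfl⟩ := MvPolynomial.isUnit_iff_eq_C_of_isReduced.1 ha
  exact ⟨κ, hκ.ne_zero, rfl⟩

/-- If `g ∣ f` in `ℚ[x][T]`, `f = C(c) · Rh` with `Rh` monic and `c ≠ 0`, then the leading
coefficient of `g` is a non-zero rational constant `κ` and `κ⁻¹ g` is a monic divisor of `Rh`.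
[folklore] -/
theorem exists_monic_of_dvd {f g Rh : (MvPolynomial (Fin d) ℚ)[X]} {c : ℚ} (hc : c ≠ 0)
    (hf : f = C (MvPolynomial.C c) * Rh) (hRh : Rh.Monic) (hg : g ∣ f) :
    ∃ κ : ℚ, κ ≠ 0 ∧ (C (MvPolynomial.C κ⁻¹) * g).Monic ∧ C (MvPolynomial.C κ⁻¹) * g ∣ Rh ∧
      g = C (MvPolynomial.C κ) * (C (MvPolynomial.C κ⁻¹) * g) := by
  obtain ⟨h, rfl⟩ := hg
  have hunitC : IsUnit (C (MvPolynomial.C c) : (MvPolynomial (Fin d) ℚ)[X]) :=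
    (MvPolynomial.isUnit_iff_eq_C_of_isReduced.2 ⟨c, isUnit_iff_ne_zero.2 hc, rfl⟩).map C
  have hlc : g.leadingCoeff * h.leadingCoeff = MvPolynomial.C c := by
    rw [← leadingCoeff_mul, hf, leadingCoeff_mul, leadingCoeff_C, hRh.leadingCoeff, mul_one]
  have hu : IsUnit g.leadingCoeff := by
    refine isUnit_of_dvd_unit (Dvd.intro _ hlc) ?_
    exact MvPolynomial.isUnit_iff_eq_C_of_isReduced.2 ⟨c, isUnit_iff_ne_zero.2 hc, rfl⟩
  obtain ⟨κ, hκ, hgl⟩ := exists_eq_C_of_isUnit hu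
  have hunit : IsUnit (C (MvPolynomial.C κ⁻¹) : (MvPolynomial (Fin d) ℚ)[X]) :=
    (MvPolynomial.isUnit_iff_eq_C_of_isReduced.2 ⟨κ⁻¹, isUnit_iff_ne_zero.2 (inv_ne_zero hκ), rfl⟩).map C
  have hmonic : (C (MvPolynomial.C κ⁻¹) * g).Monic := by
    rw [Monic, leadingCoeff_mul, leadingCoeff_C, hgl, ← MvPolynomial.C_mul, inv_mul_cancel₀ hκ,
      MvPolynomial.C_1]
  refine ⟨κ, hκ, hmonic, ?_, ?_⟩
  · -- `κ⁻¹ g ∣ Rh = c⁻¹ g h`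
    have hRh' : Rh = C (MvPolynomial.C c⁻¹) * (g * h) := by
      rw [hf, ← mul_assoc, ← Polynomial.C_mul, ← MvPolynomial.C_mul, inv_mul_cancel₀ hc,
        MvPolynomial.C_1, Polynomial.C_1, one_mul]
    have hunitc : IsUnit (C (MvPolynomial.C c⁻¹) : (MvPolynomial (Fin d) ℚ)[X]) :=
      (MvPolynomial.isUnit_iff_eq_C_of_isReduced.2 ⟨c⁻¹, isUnit_iff_ne_zero.2 (inv_ne_zero hc), rfl⟩).map C
    rw [hRh']
    exact hunitc.dvd_mul_left.2 (hunit.mul_left_dvd.2 (dvd_mul_right g h))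
  · rw [← mul_assoc, ← Polynomial.C_mul, ← MvPolynomial.C_mul, mul_inv_cancel₀ hκ,
      MvPolynomial.C_1, Polynomial.C_1, one_mul]

/-- **Algebraic preparation of `(B, Q)`.** Sign presentation of `B`, a rational shear making the
total product monic in the last variable, and the monic last-variable forms of the `Q_j` and of the
non-zero presentation polynomials, with their evaluation identities at sheared points
(Jung 1908; Greuel–Pfister 2002, proof of Thm. 3.4.1; Basu–Pollack–Roy 2006, §2.3). [folklore] -/
theorem exists_shear_data (B : Set (Fin (d + 1) → ℝ)) (hB : IsSemialgebraic ℚ B) {k : ℕ}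
    (Q : Fin k → MvPolynomial (Fin (d + 1)) ℚ) (hQ : ∀ j, Q j ≠ 0) :
    ∃ (Ps : Finset (MvPolynomial (Fin (d + 1)) ℚ)) (T : Set (Ps → SignType)) (v : Fin d → ℚ)
      (Rh : (MvPolynomial (Fin d) ℚ)[X]) (Qh : Fin k → (MvPolynomial (Fin d) ℚ)[X]) (κ : Fin k → ℚ)
      (Ph : Ps → (MvPolynomial (Fin d) ℚ)[X]) (κ' : Ps → ℚ),
      B = {x | (fun p : Ps => SignType.sign (MvPolynomial.aeval x (p : MvPolynomial (Fin (d + 1)) ℚ))) ∈ T} ∧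
      Rh.Monic ∧ (∀ j, κ j ≠ 0 ∧ (Qh j).Monic ∧ Qh j ∣ Rh) ∧
      (∀ p : Ps, (p : MvPolynomial (Fin (d + 1)) ℚ) ≠ 0 → κ' p ≠ 0 ∧ (Ph p).Monic ∧ Ph p ∣ Rh) ∧
      (∀ j (z : Fin (d + 1) → ℝ),
        MvPolynomial.aeval (Fin.snoc (fun i : Fin d => z (Fin.castSucc i) +
          algebraMap ℚ ℝ (v i) * z (Fin.last d)) (z (Fin.last d)) : Fin (d + 1) → ℝ) (Q j) =
        algebraMap ℚ ℝ (κ j) *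
          ((Qh j).map (MvPolynomial.eval₂Hom (algebraMap ℚ ℝ) (Fin.init z))).eval (z (Fin.last d))) ∧
      (∀ (p : Ps) (z : Fin (d + 1) → ℝ), (p : MvPolynomial (Fin (d + 1)) ℚ) ≠ 0 →
        MvPolynomial.aeval (Fin.snoc (fun i : Fin d => z (Fin.castSucc i) +
          algebraMap ℚ ℝ (v i) * z (Fin.last d)) (z (Fin.last d)) : Fin (d + 1) → ℝ)
            (p : MvPolynomial (Fin (d + 1)) ℚ) =
        algebraMap ℚ ℝ (κ' p) *
          ((Ph p).map (MvPolynomial.eval₂Hom (algebraMap ℚ ℝ) (Fin.init z))).eval (z (Fin.last d))) := by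
  classical
  obtain ⟨Ps, T, hBT⟩ := hB.exists_eq_setOf_signVec_mem
  -- the total product and the shear
  set R₀ : MvPolynomial (Fin (d + 1)) ℚ := (∏ j, Q j) * ∏ p ∈ Ps.filter (· ≠ 0), p with hR₀
  have hR₀ne : R₀ ≠ 0 := mul_ne_zero (Finset.prod_ne_zero_iff.2 fun j _ => hQ j)
    (Finset.prod_ne_zero_iff.2 fun p hp => (Finset.mem_filter.1 hp).2)
  have hQR₀ : ∀ j, Q j ∣ R₀ := fun j =>
    (Finset.dvd_prod_of_mem Q (Finset.mem_univ j)).trans (dvd_mul_right _ _)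
  have hPR₀ : ∀ p : Ps, (p : MvPolynomial (Fin (d + 1)) ℚ) ≠ 0 →
      (p : MvPolynomial (Fin (d + 1)) ℚ) ∣ R₀ := fun p hp =>
    (Finset.dvd_prod_of_mem (fun q => q) (Finset.mem_filter.2 ⟨p.2, hp⟩)).trans (dvd_mul_left _ _)
  clear_value R₀
  set ρ : MvPolynomial (Fin (d + 1)) ℚ →ₐ[ℚ] MvPolynomial (Fin (d + 1)) ℚ :=
    MvPolynomial.rename (finRotate (d + 1)) with hρ
  have hρinj : Function.Injective ρ := MvPolynomial.rename_injective _ (finRotate (d + 1)).injective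
  have hR₀ρ : ρ R₀ ≠ 0 := (map_ne_zero_iff _ hρinj).2 hR₀ne
  set S : Finset ℚ := (Finset.range ((ρ R₀).totalDegree + 1)).image (Nat.cast : ℕ → ℚ) with hS
  have hScard : (ρ R₀).totalDegree < S.card := by
    rw [hS, Finset.card_image_of_injective _ Nat.cast_injective, Finset.card_range]
    exact Nat.lt_succ_self _
  obtain ⟨v, -, c, hc, hmonic, -⟩ := exists_linearChange_monic hR₀ρ S hScard
  -- the last-variable form `q♯`
  set sharp : MvPolynomial (Fin (d + 1)) ℚ →ₐ[ℚ] (MvPolynomial (Fin d) ℚ)[X] :=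
    ((MvPolynomial.finSuccEquiv ℚ d).toAlgHom.comp (linearChange v)).comp ρ with hsharp
  have hsharp_apply : ∀ q, sharp q =
      MvPolynomial.finSuccEquiv ℚ d (linearChange v (MvPolynomial.rename (finRotate (d + 1)) q)) :=
    fun q => rfl
  clear_value sharp
  set Rh := MvPolynomial.finSuccEquiv ℚ d (linearChange v (MvPolynomial.C c * ρ R₀)) with hRh
  have hRh_eq : C (MvPolynomial.C c) * sharp R₀ = Rh := by
    rw [hRh, map_mul (linearChange v), map_mul (MvPolynomial.finSuccEquiv ℚ d),
      MvPolynomial.algHom_C, MvPolynomial.algebraMap_eq, hsharp_apply]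
    congr 1
    rw [MvPolynomial.finSuccEquiv_apply, MvPolynomial.eval₂Hom_C]
    rfl
  have hf : sharp R₀ = C (MvPolynomial.C c⁻¹) * Rh := by
    rw [← hRh_eq, ← mul_assoc, ← Polynomial.C_mul, ← MvPolynomial.C_mul, inv_mul_cancel₀ hc,
      MvPolynomial.C_1, Polynomial.C_1, one_mul]
  -- divisors
  have hQdvd : ∀ j, sharp (Q j) ∣ sharp R₀ := fun j =>
    map_dvd (sharp : MvPolynomial (Fin (d + 1)) ℚ →+* (MvPolynomial (Fin d) ℚ)[X]) (hQR₀ j)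
  have hPdvd : ∀ p : Ps, (p : MvPolynomial (Fin (d + 1)) ℚ) ≠ 0 →
      sharp (p : MvPolynomial (Fin (d + 1)) ℚ) ∣ sharp R₀ := fun p hp =>
    map_dvd (sharp : MvPolynomial (Fin (d + 1)) ℚ →+* (MvPolynomial (Fin d) ℚ)[X]) (hPR₀ p hp)
  have hQ' : ∀ j, ∃ κ : ℚ, κ ≠ 0 ∧ (C (MvPolynomial.C κ⁻¹) * sharp (Q j)).Monic ∧
      C (MvPolynomial.C κ⁻¹) * sharp (Q j) ∣ Rh ∧
      sharp (Q j) = C (MvPolynomial.C κ) * (C (MvPolynomial.C κ⁻¹) * sharp (Q j)) := fun j =>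
    exists_monic_of_dvd (inv_ne_zero hc) hf hmonic (hQdvd j)
  choose κ hκ hQmonic hQRh hQeq using hQ'
  have hP' : ∀ p : Ps, ∃ κ' : ℚ, ((p : MvPolynomial (Fin (d + 1)) ℚ) ≠ 0 → κ' ≠ 0 ∧
      (C (MvPolynomial.C κ'⁻¹) * sharp (p : MvPolynomial (Fin (d + 1)) ℚ)).Monic ∧
      C (MvPolynomial.C κ'⁻¹) * sharp (p : MvPolynomial (Fin (d + 1)) ℚ) ∣ Rh ∧
      sharp (p : MvPolynomial (Fin (d + 1)) ℚ) =
        C (MvPolynomial.C κ') * (C (MvPolynomial.C κ'⁻¹) * sharp (p : MvPolynomial (Fin (d + 1)) ℚ))) := by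
    intro p
    by_cases hp : (p : MvPolynomial (Fin (d + 1)) ℚ) = 0
    · exact ⟨1, fun h => (h hp).elim⟩
    · obtain ⟨κ', h1, h2, h3, h4⟩ := exists_monic_of_dvd (inv_ne_zero hc) hf hmonic (hPdvd p hp)
      exact ⟨κ', fun _ => ⟨h1, h2, h3, h4⟩⟩
  choose κ' hκ' using hP'
  refine ⟨Ps, T, v, Rh, fun j => C (MvPolynomial.C (κ j)⁻¹) * sharp (Q j), κ,
    fun p => C (MvPolynomial.C (κ' p)⁻¹) * sharp (p : MvPolynomial (Fin (d + 1)) ℚ), κ', hBT, hmonic,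
    fun j => ⟨hκ j, hQmonic j, hQRh j⟩, fun p hp => ⟨(hκ' p hp).1, (hκ' p hp).2.1, (hκ' p hp).2.2.1⟩,
    fun j z => ?_, fun p z hp => ?_⟩
  · rw [← aeval_shear, ← hsharp_apply]
    conv_lhs => rw [hQeq j]
    rw [Polynomial.map_mul, Polynomial.map_C, eval_mul, eval_C, MvPolynomial.eval₂Hom_C]
  · rw [← aeval_shear, ← hsharp_apply]
    conv_lhs => rw [(hκ' p hp).2.2.2]
    rw [Polynomial.map_mul, Polynomial.map_C, eval_mul, eval_C, MvPolynomial.eval₂Hom_C]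

end Literature.NumberTheory.Transcendental.JungPreparation
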